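import Mathlib.Data.Real.Basic
import Mathlib.Tactic.LinearCombination
import Mathlib.Tactic.Linarith
import Mathlib.Tactic.Positivity
import HarnessLib

/-!
# QUANT lane R8, T-DEC, binder (II) `ConvClosedTResidue`: LS-CORE, pattern LMG — polynomial certificates of the breakpoint inequalities (part R0: Bernstein coefficient polynomial B0 (value at t = t_E) of the leaf kBw_3PHf_LHQp (4 variables); B3 coincides with LSCoreLLG.lcell_L9_B3)

builds on p205010 (kernel theorem, internal audit signed; external expert review pending)

Support file (`--supports stmt-CriticalPhenomena-4575`), QUANT lane seat prim-quant-census-1 (gen 22), rung R8 of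
`run/shared/lean/prim/quant/LADDER.md`.  Theorems only (real polynomial inequalities), standard axioms, no sorries.  Memo
`run/shared/lean/prim/quant/prim-quant-census-1/LSCORE-G22.md` (derivation of the forms), code `code/s5_final.py` (forms), `code/cert5.py`
(certificates: Handelman products of the region generators, LP by HiGHS, exact rational repair) in the seat folder of census-1 g22.

COORDINATES (memo §2).  The light slice `(1−γ)·shift_p ν_B + γ·shift_m ν_B` of the Type-I atom `ν_B` (lows `l < l′`, absorber `h`, light
rate `ρ_ℓ < x`, expensive rate `ρ_e > x`) by the light credit pair `{p, m; γ}` (`γ = x² + (1−x)ρ_c`) is scale free in the unit `e = h − l′`: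
`x` the floor, `r = ρ_ℓ`, `t = (l′ − l)/e`, `w = (m − p)/e ≤ 1` (the span ratio ω) and `d = ρ_c·w` (so `A = r + d` and `B = A + 2t` are the
deficits `(T − 2(p+l′))/e`, `(T − 2(p+l))/e` of the two lows, `D = t(2 − x² − (1−x)r) − x(x−r) > 0` the denominator of the tail weights
`λ = (x−r)(1−t−r)/D`, `λ′ = (1+x−r)(r−x+t(2−x))/D`).  Each lemma is ONE breakpoint inequality of the two-low greedy (`…QuantTwoLowGreedy`)
on ONE light/heavy/absent branch of the six cross pairs, cleared of its (positive) denominators: `0 ≤ N` on the cell cut out by the listed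
sign conditions, with an explicit certificate `N = Σ cᵢ·(product of conditions)`, `cᵢ ≥ 0`, replayed by `linear_combination`.

[this work].  Nothing here is cited as a published result.  The gluing rows served [cite: KozmaNitzan2024, Conjecture 3 (p. 15)];
product measure [cite: Grimmett1999, §1.3 p. 10].
-/

namespace Summit.CriticalPhenomena.PercolationContinuityZ3.Theorems

namespace Quant

namespace LawDec

namespace LSCoreLMG

set_option maxHeartbeats 8000000 in
set_option maxRecDepth 20000 in
/-- **cell `LMG_L4_B0`** (breakpoint inequality; branch `B0`: pre-routing case and light/heavy/absent letters of the cross pairs): the cleared obligation is an exact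
nonnegative combination of 8 products of the region's sign conditions (LP certificate found with HiGHS, exact rational repair,
identity re-verified by an independent polynomial engine). [this work] -/
theorem lcell_L4_B0 (x r d w : ℝ) (h0 : 0 ≤ x) (h1 : 0 ≤ -x + 1) (h3 : 0 ≤ -r + x) (h4 : 0 ≤ w) (h5 : 0 ≤ -w + 1) (h6 : 0 ≤ d) (h7 : 0 ≤ x * w - d) (h11 : 0 ≤ -2 * x ^ (2:ℕ) * w + 2 * x * d + w - 2 * d) (h12 : 0 ≤ x * d + x * r - 2 * d - r - 2 * x + 2) :
    0 ≤ x ^ (3:ℕ) * d * w ^ (2:ℕ) + x ^ (3:ℕ) * r * w ^ (2:ℕ) - x ^ (2:ℕ) * d * w ^ (2:ℕ) - 2 * x ^ (2:ℕ) * d ^ (2:ℕ) * w - 2 * x ^ (2:ℕ) * r * w ^ (2:ℕ) - 2 * x ^ (2:ℕ) * r * d * w - 2 * x ^ (3:ℕ) * w ^ (2:ℕ) - x * d * w ^ (2:ℕ) + 3 * x * d ^ (2:ℕ) * w + x * d ^ (3:ℕ) + 3 * x * r * d * w + x * r * d ^ (2:ℕ) + 4 * x ^ (2:ℕ) * w ^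 (2:ℕ) + 4 * x ^ (2:ℕ) * d * w - 2 * d * w ^ (2:ℕ) + 2 * d ^ (2:ℕ) * w - 2 * d ^ (3:ℕ) - r * d * w - r * d ^ (2:ℕ) - 6 * x * d * w - 2 * x * d ^ (2:ℕ) + 2 * d * w + 2 * d ^ (2:ℕ) := by
  linear_combination (1 : ℝ) * (mul_nonneg h7 h7)
    + (1 : ℝ) * (mul_nonneg (mul_nonneg h1 h7) h7)
    + (1 : ℝ) * (mul_nonneg (mul_nonneg h3 h4) h6)
    + (3 / 2 : ℝ) * (mul_nonneg (mul_nonneg h4 h5) h6)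
    + (1 : ℝ) * (mul_nonneg (mul_nonneg h5 h6) h7)
    + (1 / 2 : ℝ) * (mul_nonneg (mul_nonneg h5 h6) h11)
    + (1 : ℝ) * (mul_nonneg (mul_nonneg h7 h7) h12)
    + (1 : ℝ) * (mul_nonneg (mul_nonneg (mul_nonneg h0 h3) h4) h7)

end LSCoreLMG

end LawDec

end Quant

end Summit.CriticalPhenomena.PercolationContinuityZ3.Theorems
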